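import Summits.ABC.IUTFork.Joshi.ATS4LegendreThetaFieldNonGalois
import Summits.ABC.IUTFork.Joshi.ATS4GaussianTwistPrime
import Summits.ABC.IUTFork.Joshi.ATS4GaussianTwistAnnulus
import Summits.ABC.IUTFork.Joshi.ATS4InitialThetaDataExistence
import Mathlib.Tactic.ComputeDegree
import HarnessLib

/-!
# [J-IV] Theorem 5.7.1 in the LITERAL reading (`ATS4.Thm571`) is FALSE: `¬ Thm571With W HasInitialThetaData` for every window

Record file (D-0012) of the abc-iut cell, block E (rung LADDER-ABC:A2.E; seat abc-iut-E-t28, slot T-28 = [J-IV] §5.4–5.7,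
authors-first companion chain deciding the literal @[claim] `ATS4.Thm571` of the LANDED row J4:Thm5.7.1). TAKES NO SIDE on
[IUTchIII] Cor. 3.12, on the claims of K. Joshi, or on S. Mochizuki's reports on them; CLASSICAL arithmetic of `ℚ(√−1)`,
kernel-checked; typed ≠ proved; NO abc claim. No `Cor312*`/`Thm311*` import (E-PLAN R14).

SOURCE. K. Joshi, *Construction of Arithmetic Teichmüller Spaces IV*, arXiv:2403.10430v2 (UNREFEREED), Thm. 5.7.1, p.53
l.31–45 (cell render `HOME/lit/renders/Joshi-arxiv-2403.10430/p0053.txt`): «… `C_λ: y² = x(x−1)(x−λ)` … `L = L_mod(√−1,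
C_λ[2·3·5])` … Then there exists a prime `ℓ` … such that `C_λ` satisfies Initial Theta Data [Joshi, 2024c, §3.1, §3.3] … with
the prime `ℓ`»; [J-III] arXiv:2401.13508v4 §3.3 (9), p.28: «`L/L_mod` is a Galois extension» (= [IUTchI] Def. 3.1 (b)). The tree
typed this AS PRINTED as `ATS4.Thm571 := Thm571With printedWindow HasInitialThetaData` (p430905, E-t28 g0), `HasInitialThetaData
P ℓ` demanding, for every theta field `F = F_tpd(√−1, C_λ[15])` of `λ` (`Cor22.IsThetaField`), an `ATS3.InitialThetaData F L′ L̄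
C_{λ,F} ℓ` (E-t6), whose field `isGalois_fieldOfModuli` is «(9)»; flag (f)/N1 of the inventory (E-t6 audit N1/N2) warned that
(9) can fail for the Legendre model. THIS FILE settles the literal reading NEGATIVELY.

WHAT IS PROVED. `mpoly_gaussPoint` (the minimal polynomial of `λ_{a,b}` is `X² − tX + 1`, `t = −4ab/p`) and
`prime_eq_of_traceLam_eq` (`t` determines `p`): the points `P_{a,b}` have pairwise distinct minimal polynomials;
`cond562_annulus_two` ((5.6.2) holds on the annulus subset: `‖j(y)‖ ≤ 2⁵` on `K_2`); `not_hasInitialThetaData_gaussPoint` (no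
`ℓ` works at `P_{a,b}`, by `not_isGalois_fieldOfModuli_thetaField` with `σ₀` = complex conjugation, `v = (a + bζ₄)`);
**`not_thm571With_hasInitialThetaData`** — with `Z` = the annulus subset (support `{∞,2}`, radius `1/2`), `d = 2`, the points
`P_{a,b}`, `p = a² + b²` prime `≡ 1 (mod 4)`, `p ≠ 5` (infinitely many: Mathlib's `Nat.infinite_setOf_prime_modEq_one` and
Fermat's `Nat.Prime.sq_add_sq`), defeat every finite `Exc`; hence **`not_thm571 : ¬ Thm571`** and **`not_thm571Lem587`**.
READING OF THE RESULT (numbers, not adjectives): the MODEL readings stay PROVED — `thm571Mod_holds` (p433999),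
`thm571Mod412_holds` (p439722), `thm571Conditions_holds` (p432027); what is false is exactly the printed pairing «Legendre curve
`C_λ` + `L = L_mod(√−1, C_λ[30])`» with clause (9), a LOCATED misstatement shared with [IUTchIV] Thm. 1.10's printed `F` (cell
finding F-L5t7-1, now a kernel theorem). Nothing here bears on [IUTchIII] Cor. 3.12. [claim: Joshi2024ATS4, status: disputed]
-/

noncomputable section

open scoped Classical

open NumberField IsDedekindDomain IsCyclotomicExtension Polynomial
open Literature.IUT.LogVolume Literature.IUT.LogVolume.Cor22
open Literature.NumberTheory.DiophantineGeometry.GenEll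

namespace Summit.ABC.IUTFork.Joshi.ATS4

/-! ## 5. The minimal polynomial of `λ_{a,b}` and the refutation of the literal Thm. 5.7.1 -/

section Refutation

variable {a b : ℕ}

/-- The minimal polynomial of `λ_{a,b}` over `ℚ` is `X² − t·X + 1`, `t = −4ab/p`. [folklore] -/
theorem mpoly_gaussPoint (hp : (a ^ 2 + b ^ 2).Prime) (hp2 : a ^ 2 + b ^ 2 ≠ 2) :
    (gaussPoint a b).mpoly = X ^ 2 - C (traceLam a b) * X + 1 := by
  have hmin := gaussPoint_isMinimal hp hp2
  have hdeg : (gaussPoint a b).mpoly.natDegree = 2 := by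
    rw [NFPoint.natDegree_mpoly _ hmin]; exact finrank_K4
  have hq : (X ^ 2 - C (traceLam a b) * X + 1 : ℚ[X]).Monic := by monicity!
  have hq2 : (X ^ 2 - C (traceLam a b) * X + 1 : ℚ[X]).natDegree ≤ 2 := by compute_degree!
  have hroot : aeval (lam a b) (X ^ 2 - C (traceLam a b) * X + 1 : ℚ[X]) = 0 := by
    have h := lam_add_inv hp.ne_zero
    have h0 := lam_ne_zero hp.ne_zero
    simp only [map_add, map_sub, map_mul, map_pow, aeval_X, aeval_C, map_one, eq_ratCast]
    rw [← h]
    field_simp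
    ring
  have hdvd : minpoly ℚ (lam a b) ∣ X ^ 2 - C (traceLam a b) * X + 1 := minpoly.dvd ℚ _ hroot
  exact (Polynomial.eq_of_monic_of_dvd_of_natDegree_le (minpoly.monic (Algebra.IsIntegral.isIntegral _)) hq hdvd
    (hq2.trans (le_of_eq hdeg.symm))).symm

/-- `t = −4ab/p` determines `p` on primes `p = a² + b² ≠ 2`: `−4ab/p = −4a'b'/p'` forces `p = p'`
(`p ∤ 4ab` as `p` is odd and `0 < a, b < p`). [folklore] -/
theorem prime_eq_of_traceLam_eq {a' b' : ℕ} (hp : (a ^ 2 + b ^ 2).Prime) (hp2 : a ^ 2 + b ^ 2 ≠ 2)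
    (hp' : (a' ^ 2 + b' ^ 2).Prime) (h : traceLam a b = traceLam a' b') :
    a ^ 2 + b ^ 2 = a' ^ 2 + b' ^ 2 := by
  obtain ⟨ha, hb⟩ := pos_of_prime hp
  have hpQ : ((a : ℚ) ^ 2 + (b : ℚ) ^ 2) ≠ 0 := by exact_mod_cast hp.ne_zero
  have hp'Q : ((a' : ℚ) ^ 2 + (b' : ℚ) ^ 2) ≠ 0 := by exact_mod_cast hp'.ne_zero
  simp only [traceLam] at h
  rw [div_eq_div_iff hpQ hp'Q] at h
  have h1 : ((4 * a * b * (a' ^ 2 + b' ^ 2) : ℕ) : ℚ) = ((4 * a' * b' * (a ^ 2 + b ^ 2) : ℕ) : ℚ) := by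
    push_cast; linear_combination -h
  have h2 : 4 * a * b * (a' ^ 2 + b' ^ 2) = 4 * a' * b' * (a ^ 2 + b ^ 2) := by exact_mod_cast h1
  have hdvd : a ^ 2 + b ^ 2 ∣ 4 * a * b * (a' ^ 2 + b' ^ 2) := ⟨4 * a' * b', by rw [h2]; ring⟩
  have hcop4 : Nat.Coprime (a ^ 2 + b ^ 2) 4 := by
    rw [show (4 : ℕ) = 2 ^ 2 by norm_num]
    exact Nat.Coprime.pow_right 2 ((Nat.coprime_primes hp Nat.prime_two).2 hp2)
  have hcopa : Nat.Coprime (a ^ 2 + b ^ 2) a := (Nat.Prime.coprime_iff_not_dvd hp).2 fun hd => by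
    have := Nat.le_of_dvd ha hd; nlinarith
  have hcopb : Nat.Coprime (a ^ 2 + b ^ 2) b := (Nat.Prime.coprime_iff_not_dvd hp).2 fun hd => by
    have := Nat.le_of_dvd hb hd; nlinarith
  have hdvd' : a ^ 2 + b ^ 2 ∣ a' ^ 2 + b' ^ 2 :=
    ((hcop4.mul_right hcopa).mul_right hcopb).dvd_of_dvd_mul_left hdvd
  exact (Nat.prime_dvd_prime_iff_eq hp hp').1 hdvd'

/-- **(5.6.2) holds for the annulus subset**: on `K_2 = {1/2 ≤ ‖y‖ ≤ 2, 1/2 ≤ ‖y − 1‖} ⊂ ℚ̄_2` one has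
`‖j(y)‖ = ‖2⁸‖·‖y²−y+1‖³/(‖y‖²‖y−1‖²) ≤ 2⁻⁸·7³·16 ≤ 2⁵`. [claim: Joshi2024ATS4, status: disputed] -/
theorem cond562_annulus_two : Cond562 (CBData.annulus {2} (fun p hp => by rw [Finset.mem_singleton.1 hp]; exact Nat.prime_two)
      (1 / 2) (by norm_num) le_rfl) := by
  refine ⟨-5, fun y hy => ?_⟩
  have hy' : y ∈ CBData.annNon 2 (1 / 2) := hy
  rw [CBData.mem_annNon_iff] at hy'
  obtain ⟨h1, h2, h3⟩ := hy'
  have h2n : ‖(2 : PadicAlgCl 2)‖ = 2⁻¹ := by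
    have h := Padic.norm_p (p := 2)
    simp only [Nat.cast_ofNat] at h
    rw [← map_ofNat (algebraMap ℚ_[2] (PadicAlgCl 2)) 2, PadicAlgCl.norm_extends, h]
  have hy0 : 0 < ‖y‖ := lt_of_lt_of_le (by norm_num) h1
  have hy1 : 0 < ‖y - 1‖ := lt_of_lt_of_le (by norm_num) h3
  have hnum : ‖y ^ 2 - y + 1‖ ≤ 7 := by
    have hy2 : ‖y‖ ≤ 2 := by simpa using h2
    calc ‖y ^ 2 - y + 1‖ ≤ ‖y ^ 2 - y‖ + ‖(1 : PadicAlgCl 2)‖ := norm_add_le (y ^ 2 - y) 1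
      _ ≤ (‖y ^ 2‖ + ‖y‖) + 1 := by rw [norm_one]; exact add_le_add_left (norm_sub_le (y ^ 2) y) 1
      _ ≤ (2 ^ 2 + 2) + 1 := by rw [norm_pow]; nlinarith [norm_nonneg y]
      _ = 7 := by norm_num
  rw [jInv, norm_div, norm_mul, norm_pow, norm_pow, h2n, norm_mul, norm_pow, norm_pow,
    div_le_iff₀ (by positivity)]
  have hden : (1 / 2 : ℝ) ^ 2 * (1 / 2) ^ 2 ≤ ‖y‖ ^ 2 * ‖y - 1‖ ^ 2 :=
    mul_le_mul (pow_le_pow_left₀ (by norm_num) h1 2) (pow_le_pow_left₀ (by norm_num) h3 2) (by positivity)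
      (by positivity)
  have hnum3 : ‖y ^ 2 - y + 1‖ ^ 3 ≤ 7 ^ 3 := pow_le_pow_left₀ (norm_nonneg _) hnum 3
  have : (2 : ℝ) ^ (-(-5 : ℤ)) = 32 := by norm_num
  rw [this]
  nlinarith [hden, hnum3, pow_nonneg (norm_nonneg (y ^ 2 - y + 1)) 3]

open Literature.IUT.HodgeTheaters in
/-- **The literal reading of [J-IV] Thm. 5.7.1 fails at every `P_{a,b}`**: for `p = a² + b²` a prime `≠ 2, 5`, NO prime `ℓ`
has `HasInitialThetaData (P_{a,b}) ℓ` — the printed theta field of `λ_{a,b}` is not Galois over `F_mod = ℚ`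
(`not_isGalois_fieldOfModuli_thetaField` with `σ₀` = complex conjugation, `v = (a + bζ₄)`, `ord_v(λ) = 1`), so clause (9) of
Joshi's Initial Theta Data cannot hold. [claim: Joshi2024ATS4, status: disputed] -/
theorem not_hasInitialThetaData_gaussPoint (hp : (a ^ 2 + b ^ 2).Prime) (hp2 : a ^ 2 + b ^ 2 ≠ 2)
    (hp3 : a ^ 2 + b ^ 2 ≠ 3) (hp5 : a ^ 2 + b ^ 2 ≠ 5) (ℓ : ℕ) : ¬ HasInitialThetaData (gaussPoint a b) ℓ := by
  intro h
  have hU := gaussPoint_inU hp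
  obtain ⟨F, hNF, hF⟩ := Cor22.exists_isThetaField (gaussPoint a b) hU
  haveI := hNF
  obtain ⟨L', _, _, _, Lbar, _, _, _, ⟨D⟩⟩ := h hU F hF
  haveI := Cor22.thetaCurve_isElliptic hU F
  exact not_isGalois_fieldOfModuli_thetaField (P := gaussPoint a b) hU conjK4 (conjK4_lam hp.ne_zero) ⟨zeta4, zeta4_sq⟩
    (jInv_lam hp.ne_zero (by have := (pos_of_prime hp).1; omega)) (primeV hp) (valuation_two_primeV hp hp2)
    (fifteen_notMem_primeV hp hp3 hp5) (by show 0 < ord K4 (primeV hp) (lam a b); rw [ord_lam hp hp2]; norm_num)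
    (by show Odd (ord K4 (primeV hp) (lam a b)); rw [ord_lam hp hp2]; exact odd_one) F hF D.isGalois_fieldOfModuli

/-- **Thm. 5.7.1 in the literal reading is FALSE for every `ℓ`-window `W`**: `¬ Thm571With W HasInitialThetaData`.
Take `Z` = the annulus subset (support `{∞, 2}`, radius `1/2`; (5.6.2) holds), `d = 2`; the points `P_{a,b}`, `p = a² + b²`
prime `≡ 1 (mod 4)`, `p ≠ 5`, lie in `Z ∩ U(ℚ̄)^{≤2}` with pairwise distinct minimal polynomials `X² + (4ab/p)X + 1`
(infinitely many by Dirichlet/Fermat, Mathlib), so one of them avoids any finite `Exc`; at it no `ℓ` works.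
[claim: Joshi2024ATS4, status: disputed] -/
theorem not_thm571With_hasInitialThetaData (W : NFPoint → ℕ → Prop) : ¬ Thm571With W HasInitialThetaData := by
  intro h
  have h2p : ∀ p ∈ ({2} : Finset ℕ), p.Prime := fun p hp => by rw [Finset.mem_singleton.1 hp]; exact Nat.prime_two
  obtain ⟨Exc, hfin, -, hmain⟩ := h (CBData.annulus {2} h2p (1 / 2) (by norm_num) le_rfl)
    (CBData.annulus_supportContains {2} h2p (1 / 2) (by norm_num) le_rfl) cond562_annulus_two 2 (by norm_num)
  -- the index set and the representations `p = a² + b²`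
  set S : Set ℕ := {p : ℕ | p.Prime ∧ p ≡ 1 [MOD 4] ∧ p ≠ 5} with hS
  have hSinf : S.Infinite := by
    have h := (Nat.infinite_setOf_prime_modEq_one (by norm_num : (4 : ℕ) ≠ 0)).sdiff (Set.finite_singleton 5)
    refine h.mono ?_
    rintro p ⟨⟨hp, hmod⟩, hne⟩
    exact ⟨hp, hmod, hne⟩
  have hrep : ∀ p ∈ S, ∃ ab : ℕ × ℕ, ab.1 ^ 2 + ab.2 ^ 2 = p := by
    rintro p ⟨hp, hmod, -⟩
    haveI := Fact.mk hp
    have h4 : p % 4 ≠ 3 := by rw [hmod]; norm_num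
    obtain ⟨a, b, hab⟩ := Nat.Prime.sq_add_sq h4
    exact ⟨(a, b), hab⟩
  choose! ab hab using hrep
  -- the points and their minimal polynomials
  have hP : ∀ p ∈ S, (ab p).1 ^ 2 + (ab p).2 ^ 2 = p ∧ ((ab p).1 ^ 2 + (ab p).2 ^ 2).Prime ∧
      (ab p).1 ^ 2 + (ab p).2 ^ 2 ≠ 2 ∧ (ab p).1 ^ 2 + (ab p).2 ^ 2 ≠ 3 ∧ (ab p).1 ^ 2 + (ab p).2 ^ 2 ≠ 5 := by
    rintro p hpS
    obtain ⟨hp, hmod, h5⟩ := hpS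
    have he := hab p ⟨hp, hmod, h5⟩
    refine ⟨he, by rw [he]; exact hp, ?_, ?_, by rw [he]; exact h5⟩
    · rw [he]; rintro rfl; norm_num [Nat.ModEq] at hmod
    · rw [he]; rintro rfl; norm_num [Nat.ModEq] at hmod
  have hinj : Set.InjOn (fun p => (gaussPoint (ab p).1 (ab p).2).mpoly) S := by
    intro p hp p' hp' heq
    obtain ⟨he, hpr, h2, -⟩ := hP p hp
    obtain ⟨he', hpr', h2', -⟩ := hP p' hp'
    simp only [mpoly_gaussPoint hpr h2, mpoly_gaussPoint hpr' h2'] at heq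
    have ht : traceLam (ab p).1 (ab p).2 = traceLam (ab p').1 (ab p').2 := by
      have := congrArg (fun q : ℚ[X] => q.coeff 1) heq
      simpa [coeff_X, coeff_C, coeff_one] using this
    rw [← he, ← he']
    exact prime_eq_of_traceLam_eq hpr h2 hpr' ht
  -- some point of the family avoids `Exc`
  have hnot : ∃ p ∈ S, gaussPoint (ab p).1 (ab p).2 ∉ Exc := by
    by_contra hall
    simp only [not_exists, not_and, not_not] at hall
    have hsub : (fun p => (gaussPoint (ab p).1 (ab p).2).mpoly) '' S ⊆ NFPoint.mpoly '' Exc := by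
      rintro _ ⟨p, hp, rfl⟩
      exact ⟨_, hall p hp, rfl⟩
    exact ((Set.infinite_image_iff hinj).2 hSinf |>.mono hsub) hfin
  obtain ⟨p, hpS, hpExc⟩ := hnot
  obtain ⟨-, hpr, h2, h3, h5⟩ := hP p hpS
  obtain ⟨ℓ, -, -, hITD⟩ := hmain _ ⟨gaussPoint_mem_annulus hpr h2, gaussPoint_mem_UPle hpr h2⟩ hpExc
  exact not_hasInitialThetaData_gaussPoint hpr h2 h3 h5 ℓ hITD

/-- **[J-IV] Theorem 5.7.1 AS PRINTED is FALSE in the literal reading** (`ATS4.Thm571` of p430905: printed `ℓ`-window,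
conclusion «`C_λ` satisfies Initial Theta Data [J-III §3.1, §3.3]» for the LEGENDRE curve and the printed `L = L_mod(√−1,
C_λ[2·3·5])`, read as `HasInitialThetaData`): clause (9) «`L/L_mod` Galois» fails at infinitely many degree-`2` points of
every admissible `Z`-window. What survives (PROVED in the tree): the readings at Mochizuki's `F_mod`-MODEL, `thm571Mod_holds`
(p433999) / `thm571Mod412_holds` (p439722), and the (P2)(P5)(P6) reading `thm571Conditions_holds` (p432027). LOCATED
misstatement, not a claim about [IUTchIII] Cor. 3.12. [claim: Joshi2024ATS4, status: disputed] -/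
theorem not_thm571 : ¬ Thm571 := not_thm571With_hasInitialThetaData printedWindow

/-- The same for the Lem-5.8.7 window (`ATS4.Thm571Lem587`): FALSE in the literal reading. [claim: Joshi2024ATS4, status: disputed] -/
theorem not_thm571Lem587 : ¬ Thm571Lem587 := not_thm571With_hasInitialThetaData lem587Window

end Refutation

end Summit.ABC.IUTFork.Joshi.ATS4

end
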